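import Mathlib
import HarnessLib
import Literature.AlgebraicGeometry.Ramification.InertiaNormalSylow
import Literature.AlgebraicGeometry.Resolution.AugmentationIdeal
import Summits.ResolutionOfSingularities.ResolutionOfSingularities.Theorems.WildQuotientsWildQuotientResolutionTameEndState
import Summits.ResolutionOfSingularities.ResolutionOfSingularities.Theorems.WildQuotientsWildQuotientResolutionTameFixedLocus

/-!
# The REICHSTEIN–YOUSSIN end state in characteristic `p`: tame fixed loci inside a stable boundary ⇒ p-closed inertia
# (crux `WildQuotients.WildQuotientResolution`, stub `stub_phaseZeroHighDim`; any embedding dimension)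

Crux stmt-ResolutionOfSingularities-15640 (`WildQuotientResolution`), registered stub `stub_phaseZeroHighDim`
(Phase 0 for `dim X′ ≥ 3`: a `G`-equivariant proper birational REGULAR model on which every inertia group is
p-closed). The all-dimensional Phase-0 designs in the tree (hand-6 lineage: ✓`TameMove`, ✓`TameOrbitMove`,
✓`ToralEndState`, ✓`ToralPhaseZero`) steer an equivariant regular model towards an END STATE at which a local
criterion certifies p-closed inertia. The criteria landed so far (✓`TameEndState`, ✓`TameEndStateFlag`,
✓`ToralEndState`) all constrain the action of the inertia group on the TOP piece `𝔪 / ((z) + 𝔪²)` of the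
boundary flag (trivial / abelian / p-closed). This file proves the criterion of Reichstein–Youssin's
resolution theorem for `G`-varieties (Canad. J. Math. 52 (2000), Thm. 4.1: in characteristic `0`, an action
in STANDARD FORM — free off a strict normal crossings divisor — has stabilisers `unipotent ⋊ diagonalisable`)
in residue characteristic `p`, where «unipotent» becomes «`p`-group» and NOTHING is asked of the top piece:

**Theorem** (`hasNormalSylow_of_tameFix_le_boundary`). Let `(R, 𝔪, κ)` be a local ring of residue
characteristic `p`, `τ : I →* (R ≃+* R)` a residue-trivial action of a finite group, and `z₁, …, z_r ∈ 𝔪 ∖ 𝔪²`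
(local equations of the boundary divisors through the point) with each LINE `κ z̄ᵢ ⊆ 𝔪/𝔪²` stable under `I`
(`τ g (zᵢ) ∈ (zᵢ) + 𝔪²`: the divisors through the point are individually `I`-stable — the boundary is
`G`-strict). Suppose that every element `g ≠ 1` of `I` of order prime to `p` has its fixed locus inside the
boundary to first order: some `zᵢ` lies in `𝔞_g + 𝔪²`, `𝔞_g = (τ g x − x : x ∈ R)` the augmentation ideal
(tree `augIdeal`). Then `I` has a normal Sylow `p`-subgroup — indeed the joint kernel `U` of the characters of
`I` on the lines `κ z̄ᵢ` is a normal `p`-subgroup with `I/U ↪ (κˣ)^r`.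

Proof. (1) TAME AVERAGING (`exists_mem_maximalIdeal_sub_eq`): if `g ^ e = 1` with `e ∈ R×`, every
augmentation `τ g x − x` (`x ∈ R`, possibly a unit) equals `τ g y − y` for some `y ∈ 𝔪`
(`y = x − e⁻¹ ∑_{k<e} τ g^k x`); hence (`exists_sub_mem_sq_of_mem_augIdeal`) every element of `𝔞_g` is
`≡ τ g y − y (mod 𝔪²)` with `y ∈ 𝔪`: the image of `𝔞_g` in `V = 𝔪/𝔪²` is `(ḡ − 1)V`. (2) TRACE
(`mem_sq_of_sub_mem_sq`): if moreover `τ g z − z ∈ 𝔪²` and `z ≡ τ g y − y (mod 𝔪²)`, then applying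
`T = ∑_{k<e} τ g^k` gives `e·z ≡ T z = T(z − (τ g y − y)) + (τ g^e y − y) ≡ 0 (mod 𝔪²)`, so `z ∈ 𝔪²`:
a semisimple operator has `V^{g} ∩ (g − 1)V = 0`. (3) Each stable line carries a character
`νᵢ : I → κˣ` (✓`FlagCore.exists_character_of_line`); let `U = ⋂ ker νᵢ`. For `u ∈ U` write
`ord u = p^a·m`, `p ∤ m`; `h = u^{p^a} ∈ U` has order `m` prime to `p`, and if `h ≠ 1` the hypothesis gives
`zᵢ ∈ 𝔞_h + 𝔪²` with `νᵢ h = 1`, i.e. `τ h zᵢ − zᵢ ∈ 𝔪²`, so `zᵢ ∈ 𝔪²` by (2) — contradiction. Hence `U` is a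
`p`-group, and `I/U ↪ (κˣ)^r` has no element of order `p` (✓`BorelCore.units_eq_one_of_pow_char_eq_one`):
✓`HasNormalSylow.of_normal_of_not_dvd_index`. No Noetherian, regularity or faithfulness hypothesis is used
(faithfulness on tame elements is implied by the hypothesis).

Comparison with the toral end state of ✓`TameEndState` (tame elements trivial on `𝔪/((z) + 𝔪²)`): for a
tame `g ≠ 1` acting faithfully with INDEPENDENT `z̄ᵢ`, `(ḡ − 1)V ⊆ ⊕ κ z̄ᵢ` is a non-zero sum of
`g`-eigenlines, so some `z̄ᵢ` is moved, and a moved boundary equation lies in `𝔞_g + 𝔪²` on the nose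
(`apply_sub_mem_augIdeal_sup`); thus the toral end state is a standard form, while the standard form asks
nothing of the top piece. The geometric reading — on a regular `G`-scheme whose TAME inert loci `Fix(h)`
(✓`TameFixedLocus`: regular, ideal `𝔞_h`) all lie in a `G`-strict normal crossings boundary, every inertia
group is p-closed — is the end state of the embedded-resolution route to Phase 0 (make the tame non-free
locus a strict normal crossings divisor by equivariant blow-ups in regular centres; known in dimension `3` via
CJS-type embedded resolution of surfaces, open beyond); the set form
`hasNormalSylow_of_tameFix_le_boundary_finset` and the boundary-free case
`hasNormalSylow_of_forall_coprime_eq_one` (off the boundary inertia is a `p`-group) are recorded for it.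

[OURS · crux stmt-ResolutionOfSingularities-15640 · helper toward `stub_phaseZeroHighDim` (the local
STANDARD-FORM end-state criterion; NOT a proof of the stub); char-`p` form of Reichstein–Youssin 2000 Thm. 4.1,
folklore local algebra, counted 0; AI-level work, weaker than expert review.] [folklore]

* `apply_pow_sub_mem_sq`, `sum_apply_pow_mem_sq` — iterates / traces of a residue-trivial automorphism
  preserve `𝔪²`-congruences;
* `exists_mem_maximalIdeal_sub_eq`, `exists_sub_mem_sq_of_mem_augIdeal` — tame averaging: `𝔞_g ≡ (g − 1)𝔪`;
* `mem_sq_of_sub_mem_sq`, `mem_sq_of_mem_augIdeal_sup` — `V^g ∩ (g − 1)V = 0` for tame `g`;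
* `exists_character_of_stable_line` — the character of `I` on a first-order-stable line `κ z̄`;
* `isPGroup_of_forall_coprime_eq_one`, `hasNormalSylow_of_ker_isPGroup`, `pi_units_eq_one_of_pow_char_eq_one`
  — group theory of the joint kernel;
* `hasNormalSylow_of_tameFix_le_boundary` (+ `_finset`, `hasNormalSylow_of_forall_coprime_eq_one`,
  `apply_sub_mem_augIdeal_sup`) — the theorem and its bookkeeping forms.
-/

-- single-problem summit: the doubled namespace component `ResolutionOfSingularities` is forced
set_option linter.dupNamespace false

open IsLocalRing Literature.AlgebraicGeometry.Ramification Literature.AlgebraicGeometry.Resolution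
open Summit.ResolutionOfSingularities.ResolutionOfSingularities.Theorems.WildQuotientResolution.BorelCore
open Summit.ResolutionOfSingularities.ResolutionOfSingularities.Theorems.WildQuotientResolution.FlagCore
open Summit.ResolutionOfSingularities.ResolutionOfSingularities.Theorems.WildQuotientResolution.TameEndState

namespace Summit.ResolutionOfSingularities.ResolutionOfSingularities.Theorems.WildQuotientResolution.StandardForm

/-! ## Group theory of the joint kernel -/

section Group

variable {I : Type*} [Group I]

/-- A finite group in which every element of order prime to `p` is trivial is a `p`-group
(`ord g = p^a·m`, `p ∤ m`, and `g^{p^a}` has order `m`). [folklore] -/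
theorem isPGroup_of_forall_coprime_eq_one {p : ℕ} [hp : Fact p.Prime] [Finite I]
    (h : ∀ g : I, (orderOf g).Coprime p → g = 1) : IsPGroup p I := by
  intro g
  obtain ⟨a, m, hm, hdec⟩ :=
    Nat.exists_eq_pow_mul_and_not_dvd (orderOf_pos g).ne' p hp.out.one_lt.ne'
  have hpa : p ^ a ≠ 0 := pow_ne_zero _ hp.out.ne_zero
  have hord : orderOf (g ^ p ^ a) = m := by
    rw [orderOf_pow_of_dvd hpa (hdec ▸ dvd_mul_right _ _), hdec, Nat.mul_div_cancel_left _
      (Nat.pos_of_ne_zero hpa)]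
  refine ⟨a, h _ ?_⟩
  rw [hord]
  exact ((Nat.Prime.coprime_iff_not_dvd hp.out).mpr hm).symm

/-- If the kernel of a homomorphism `f : I → A` into a group without elements of order `p` is a
`p`-group, then `I` has a normal Sylow `p`-subgroup (the kernel: its index is prime to `p`).
[folklore] -/
theorem hasNormalSylow_of_ker_isPGroup {p : ℕ} [Fact p.Prime] [Finite I] {A : Type*} [Group A]
    (hA : ∀ a : A, a ^ p = 1 → a = 1) (f : I →* A) (hU : IsPGroup p f.ker) :
    HasNormalSylow p I := by
  refine HasNormalSylow.of_normal_of_not_dvd_index f.ker hU fun hdvd => ?_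
  rw [Subgroup.index_eq_card] at hdvd
  obtain ⟨x, hx⟩ := exists_prime_orderOf_dvd_card' (G := I ⧸ f.ker) p hdvd
  have hyp : QuotientGroup.kerLift f x ^ p = 1 := by
    rw [← map_pow, ← hx, pow_orderOf_eq_one, map_one]
  have hx1 : x = 1 := QuotientGroup.kerLift_injective f (by rw [hA _ hyp, map_one])
  rw [hx1, orderOf_one] at hx
  exact (Fact.out : p.Prime).one_lt.ne hx

/-- A product of unit groups of fields of characteristic `p` has no element of order `p`.
[folklore] -/
theorem pi_units_eq_one_of_pow_char_eq_one {ι F : Type*} [Field F] (p : ℕ) [Fact p.Prime]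
    [CharP F p] (a : ι → Fˣ) (h : a ^ p = 1) : a = 1 :=
  funext fun i => units_eq_one_of_pow_char_eq_one p (by rw [← Pi.pow_apply, h, Pi.one_apply])

end Group

/-! ## Tame averaging in a local ring -/

section LocalRing

variable {R : Type*} [CommRing R] [IsLocalRing R] {I : Type*} [Group I]

/-- Iterates of a residue-trivial automorphism preserve congruences modulo `𝔪²`:
if `τ g z − z ∈ 𝔪²` then `τ g^k z − z ∈ 𝔪²` for every `k`. [folklore] -/
theorem apply_pow_sub_mem_sq (τ : I →* (R ≃+* R)) {g : I} {z : R}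
    (hz : τ g z - z ∈ maximalIdeal R ^ 2) (k : ℕ) : τ (g ^ k) z - z ∈ maximalIdeal R ^ 2 := by
  induction k with
  | zero => rw [pow_zero, map_one, RingAut.one_apply, sub_self]; exact zero_mem _
  | succ k ih =>
    have e : τ (g ^ (k + 1)) z - z = τ g (τ (g ^ k) z - z) + (τ g z - z) := by
      rw [pow_succ', map_mul, RingAut.mul_apply, map_sub]; ring
    rw [e]
    exact add_mem (ringAut_apply_mem_maximalIdeal_pow (τ g) 2 ih) hz

/-- The trace `∑_{k<e} τ g^k` maps `𝔪²` into `𝔪²`. [folklore] -/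
theorem sum_apply_pow_mem_sq (τ : I →* (R ≃+* R)) (g : I) (e : ℕ) {w : R}
    (hw : w ∈ maximalIdeal R ^ 2) :
    ∑ k ∈ Finset.range e, τ (g ^ k) w ∈ maximalIdeal R ^ 2 :=
  sum_mem fun k _ => ringAut_apply_mem_maximalIdeal_pow (τ (g ^ k)) 2 hw

/-- **Tame averaging.** For a residue-trivial action and `g` with `g ^ e = 1`, `e` a unit of `R`, every
augmentation `τ g x − x` (`x ∈ R` arbitrary) is the augmentation `τ g y − y` of an element `y` of the
maximal ideal, namely `y = x − e⁻¹ ∑_{k<e} τ g^k x`. [folklore] -/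
theorem exists_mem_maximalIdeal_sub_eq (τ : I →* (R ≃+* R))
    (hres : ∀ (g : I) (r : R), τ g r - r ∈ maximalIdeal R) {g : I} {e : ℕ} (he : g ^ e = 1)
    (heu : IsUnit ((e : ℕ) : R)) (x : R) :
    ∃ y ∈ maximalIdeal R, τ g y - y = τ g x - x := by
  obtain ⟨u, hu⟩ := heu.exists_left_inv
  set S : R := ∑ k ∈ Finset.range e, τ (g ^ k) x with hSdef
  refine ⟨x - u * S, ?_, ?_⟩
  · have key : x - u * S = -(u * ∑ k ∈ Finset.range e, (τ (g ^ k) x - x)) := by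
      rw [Finset.sum_sub_distrib, ← hSdef, Finset.sum_const, Finset.card_range, nsmul_eq_mul]
      have hx : u * ((e : R) * x) = x := by rw [← mul_assoc, hu, one_mul]
      rw [mul_sub, hx]; ring
    rw [key]
    exact neg_mem (Ideal.mul_mem_left _ _ (sum_mem fun k _ => hres _ _))
  · -- `τ g` fixes `u = e⁻¹` and the trace `S`
    have hgu : τ g u = u := by
      have h1 : τ g u * (e : R) = 1 := by
        rw [← map_natCast (τ g) e, ← map_mul, hu, map_one]
      calc τ g u = τ g u * (u * (e : R)) := by rw [hu, mul_one]
        _ = u * (τ g u * (e : R)) := by ring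
        _ = u := by rw [h1, mul_one]
    have hS : τ g S = S := by
      rw [hSdef, map_sum]
      have h1 : ∑ k ∈ Finset.range (e + 1), τ (g ^ k) x =
          ∑ k ∈ Finset.range e, τ (g ^ (k + 1)) x + τ (g ^ 0) x :=
        Finset.sum_range_succ' (fun k => τ (g ^ k) x) e
      have h2 : ∑ k ∈ Finset.range (e + 1), τ (g ^ k) x =
          ∑ k ∈ Finset.range e, τ (g ^ k) x + τ (g ^ e) x :=
        Finset.sum_range_succ (fun k => τ (g ^ k) x) e
      have h3 : τ (g ^ e) x = τ (g ^ 0) x := by rw [he, pow_zero]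
      have h4 : ∀ k, τ g (τ (g ^ k) x) = τ (g ^ (k + 1)) x := fun k => by
        rw [pow_succ', map_mul, RingAut.mul_apply]
      simp_rw [h4]
      linear_combination (h1.symm.trans h2) + h3
    rw [map_sub, map_mul, hgu, hS]
    ring

/-- **The augmentation ideal of a tame element is `(g − 1)𝔪` modulo `𝔪²`**: under the hypotheses of
`exists_mem_maximalIdeal_sub_eq`, every `z ∈ 𝔞_g = (τ g x − x : x ∈ R)` satisfies
`z ≡ τ g y − y (mod 𝔪²)` for some `y ∈ 𝔪`. [folklore] -/
theorem exists_sub_mem_sq_of_mem_augIdeal (τ : I →* (R ≃+* R))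
    (hres : ∀ (g : I) (r : R), τ g r - r ∈ maximalIdeal R) {g : I} {e : ℕ} (he : g ^ e = 1)
    (heu : IsUnit ((e : ℕ) : R)) {z : R} (hz : z ∈ augIdeal (τ g)) :
    ∃ y ∈ maximalIdeal R, z - (τ g y - y) ∈ maximalIdeal R ^ 2 := by
  rw [augIdeal_def] at hz
  induction hz using Submodule.span_induction with
  | mem w hw =>
    obtain ⟨x, rfl⟩ := hw
    obtain ⟨y, hy, hyx⟩ := exists_mem_maximalIdeal_sub_eq τ hres he heu x
    exact ⟨y, hy, by rw [hyx, sub_self]; exact zero_mem _⟩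
  | zero => exact ⟨0, zero_mem _, by rw [map_zero, sub_self, sub_zero]; exact zero_mem _⟩
  | add z₁ z₂ _ _ h₁ h₂ =>
    obtain ⟨y₁, hy₁, h₁⟩ := h₁
    obtain ⟨y₂, hy₂, h₂⟩ := h₂
    refine ⟨y₁ + y₂, add_mem hy₁ hy₂, ?_⟩
    have e : z₁ + z₂ - (τ g (y₁ + y₂) - (y₁ + y₂)) =
        (z₁ - (τ g y₁ - y₁)) + (z₂ - (τ g y₂ - y₂)) := by rw [map_add]; ring
    rw [e]
    exact add_mem h₁ h₂
  | smul a z _ h =>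
    obtain ⟨y, hy, h⟩ := h
    refine ⟨a * y, Ideal.mul_mem_left _ _ hy, ?_⟩
    have e : a • z - (τ g (a * y) - a * y) = a * (z - (τ g y - y)) - (τ g a - a) * τ g y := by
      rw [smul_eq_mul, map_mul]; ring
    rw [e, pow_two]
    exact sub_mem (Ideal.mul_mem_left _ _ (by rw [← pow_two]; exact h))
      (Ideal.mul_mem_mul (hres g a) (apply_mem_maximalIdeal_of_res hres g hy))

/-- **`V^g ∩ (g − 1)V = 0` for a tame `g`.** If `g ^ e = 1` with `e ∈ R×`, `τ g z − z ∈ 𝔪²` and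
`z ≡ τ g y − y (mod 𝔪²)` for some `y`, then `z ∈ 𝔪²`: applying the trace `T = ∑_{k<e} τ g^k`,
`e·z ≡ T z ≡ T (τ g y − y) = τ g^e y − y = 0`. [folklore] -/
theorem mem_sq_of_sub_mem_sq (τ : I →* (R ≃+* R)) {g : I} {e : ℕ} (he : g ^ e = 1)
    (heu : IsUnit ((e : ℕ) : R)) {z y : R} (hgz : τ g z - z ∈ maximalIdeal R ^ 2)
    (hzy : z - (τ g y - y) ∈ maximalIdeal R ^ 2) : z ∈ maximalIdeal R ^ 2 := by
  obtain ⟨u, hu⟩ := heu.exists_left_inv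
  -- the trace of `z` is `e • z` modulo `𝔪²`
  have h1 : ∑ k ∈ Finset.range e, τ (g ^ k) z - (e : R) * z ∈ maximalIdeal R ^ 2 := by
    have eq : ∑ k ∈ Finset.range e, τ (g ^ k) z - (e : R) * z =
        ∑ k ∈ Finset.range e, (τ (g ^ k) z - z) := by
      rw [Finset.sum_sub_distrib, Finset.sum_const, Finset.card_range, nsmul_eq_mul]
    rw [eq]
    exact sum_mem fun k _ => apply_pow_sub_mem_sq τ hgz k
  -- the trace kills augmentations
  have h2 : ∑ k ∈ Finset.range e, τ (g ^ k) (τ g y - y) = 0 := by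
    have h4 : ∀ k, τ (g ^ k) (τ g y - y) = τ (g ^ (k + 1)) y - τ (g ^ k) y := fun k => by
      rw [map_sub, pow_succ, map_mul, RingAut.mul_apply]
    simp_rw [h4]
    rw [Finset.sum_range_sub (fun k => τ (g ^ k) y), he, pow_zero]
    exact sub_self _
  -- the trace of `z - (τ g y - y)` lies in `𝔪²`
  have h3 : ∑ k ∈ Finset.range e, τ (g ^ k) z =
      ∑ k ∈ Finset.range e, τ (g ^ k) (z - (τ g y - y)) +
        ∑ k ∈ Finset.range e, τ (g ^ k) (τ g y - y) := by
    rw [← Finset.sum_add_distrib]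
    refine Finset.sum_congr rfl fun k _ => ?_
    rw [← map_add, sub_add_cancel]
  have hT : ∑ k ∈ Finset.range e, τ (g ^ k) z ∈ maximalIdeal R ^ 2 := by
    rw [h3, h2, add_zero]
    exact sum_apply_pow_mem_sq τ g e hzy
  have h5 : (e : R) * z ∈ maximalIdeal R ^ 2 := by
    have h := sub_mem hT h1
    rwa [sub_sub_cancel] at h
  have eq : z = u * ((e : R) * z) := by rw [← mul_assoc, hu, one_mul]
  rw [eq]
  exact Ideal.mul_mem_left _ _ h5

/-- **A first-order fixed vector in the augmentation ideal of a tame element is zero**: for `g` of order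
prime to the residue characteristic `p` acting residue-trivially, `z ∈ 𝔞_g + 𝔪²` together with
`τ g z − z ∈ 𝔪²` forces `z ∈ 𝔪²`. [folklore] -/
theorem mem_sq_of_mem_augIdeal_sup (p : ℕ) [Fact p.Prime] [CharP (ResidueField R) p]
    (τ : I →* (R ≃+* R)) (hres : ∀ (g : I) (r : R), τ g r - r ∈ maximalIdeal R) {g : I}
    (hg : (orderOf g).Coprime p) {z : R} (hz : z ∈ augIdeal (τ g) ⊔ maximalIdeal R ^ 2)
    (hgz : τ g z - z ∈ maximalIdeal R ^ 2) : z ∈ maximalIdeal R ^ 2 := by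
  have he : g ^ orderOf g = 1 := pow_orderOf_eq_one g
  have heu : IsUnit ((orderOf g : ℕ) : R) :=
    TameFixedLocus.isUnit_natCast_of_not_dvd p
      ((Nat.Prime.coprime_iff_not_dvd (Fact.out : p.Prime)).mp hg.symm)
  obtain ⟨a, ha, b, hb, rfl⟩ := Submodule.mem_sup.mp hz
  obtain ⟨y, -, hy⟩ := exists_sub_mem_sq_of_mem_augIdeal τ hres he heu ha
  refine mem_sq_of_sub_mem_sq τ he heu hgz (y := y) ?_
  have e : a + b - (τ g y - y) = (a - (τ g y - y)) + b := by ring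
  rw [e]
  exact add_mem hy hb

/-- **The character on a first-order-stable line.** For a residue-trivial action and `z ∈ 𝔪` with
`τ g z ∈ (z) + 𝔪²` for all `g`, some character `ν : I → κˣ` (the scalar of `g` on `z̄ ∈ 𝔪/𝔪²`) has
`τ g z − z ∈ 𝔪²` whenever `ν g = 1` (✓`FlagCore.exists_character_of_line` applied to the line
`(z) + 𝔪²`). [folklore] -/
theorem exists_character_of_stable_line (τ : I →* (R ≃+* R))
    (hres : ∀ (g : I) (r : R), τ g r - r ∈ maximalIdeal R) {z : R} (hz : z ∈ maximalIdeal R)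
    (hstab : ∀ g : I, τ g z ∈ Ideal.span {z} ⊔ maximalIdeal R ^ 2) :
    ∃ ν : I →* (ResidueField R)ˣ, ∀ g, ν g = 1 → τ g z - z ∈ maximalIdeal R ^ 2 := by
  set L : Ideal R := Ideal.span {z} ⊔ maximalIdeal R ^ 2 with hLdef
  have hK2 : maximalIdeal R ^ 2 ≤ L := le_sup_right
  have hLm : L ≤ maximalIdeal R :=
    sup_le ((Ideal.span_singleton_le_iff_mem _).mpr hz) (Ideal.pow_le_self two_ne_zero)
  have hgen : ∀ r ∈ L, ∃ a : R, r - a * z ∈ maximalIdeal R ^ 2 := by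
    intro r hr
    obtain ⟨a', ha', b, hb, rfl⟩ := Submodule.mem_sup.mp hr
    obtain ⟨a, rfl⟩ := Ideal.mem_span_singleton'.mp ha'
    exact ⟨a, by rwa [add_sub_cancel_left]⟩
  have hLτ : ∀ (g : I), ∀ r ∈ (L : Set R), τ g r ∈ (L : Set R) := by
    intro g r hr
    obtain ⟨a, ha⟩ := hgen r hr
    have e : τ g r = τ g (r - a * z) + τ g a * τ g z := by rw [map_sub, map_mul]; ring
    rw [SetLike.mem_coe, e]
    exact add_mem (hK2 (apply_mem_sq_of_res τ g ha)) (Ideal.mul_mem_left _ _ (hstab g))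
  have hzL : z ∈ (L : Set R) := Ideal.mem_sup_left (Ideal.mem_span_singleton_self z)
  obtain ⟨ν, hν⟩ := exists_character_of_line τ hres (L := (L : Set R)) (fun r hr => hLm hr) hLτ
    (maximalIdeal R ^ 2) (fun g x hx => apply_mem_sq_of_res τ g hx) le_rfl hzL
    (fun r hr => hgen r hr)
  exact ⟨ν, fun g hg => hν g hg z hzL⟩

/-! ## The standard-form criterion -/

/-- **Reichstein–Youssin in characteristic `p`: tame fixed loci inside a strict stable boundary ⇒ p-closed
inertia** (crux stmt-ResolutionOfSingularities-15640, toward `stub_phaseZeroHighDim`; any embedding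
dimension, any local ring). Let `(R, 𝔪, κ)` be a local ring of residue characteristic `p`, `τ` a
residue-trivial action of the finite group `I` on `R`, `z : Fin r → 𝔪 ∖ 𝔪²` with every line `κ z̄ᵢ` stable
(`τ g (z i) ∈ (z i) + 𝔪²`), and suppose every `g ≠ 1` of order prime to `p` has some `z i ∈ 𝔞_{τ g} + 𝔪²`
(its fixed locus lies in the boundary divisor `z i = 0`, to first order). Then `I` has a normal Sylow
`p`-subgroup: the joint kernel of the line characters is a normal `p`-subgroup of index prime to `p`.
[folklore; characteristic-`0` form: Reichstein–Youssin, Canad. J. Math. 52 (2000) Thm. 4.1] -/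
theorem hasNormalSylow_of_tameFix_le_boundary (p : ℕ) [Fact p.Prime] [CharP (ResidueField R) p]
    [Finite I] (τ : I →* (R ≃+* R)) (hres : ∀ (g : I) (r : R), τ g r - r ∈ maximalIdeal R)
    {r : ℕ} (z : Fin r → R) (hz : ∀ i, z i ∈ maximalIdeal R) (hz2 : ∀ i, z i ∉ maximalIdeal R ^ 2)
    (hstab : ∀ (g : I) (i : Fin r), τ g (z i) ∈ Ideal.span {z i} ⊔ maximalIdeal R ^ 2)
    (hfix : ∀ g : I, g ≠ 1 → (orderOf g).Coprime p →
      ∃ i, z i ∈ augIdeal (τ g) ⊔ maximalIdeal R ^ 2) :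
    HasNormalSylow p I := by
  choose ν hν using fun i => exists_character_of_stable_line τ hres (hz i) (fun g => hstab g i)
  let f : I →* (Fin r → (ResidueField R)ˣ) := MonoidHom.pi ν
  have hf : ∀ g : I, f g = 1 → ∀ i, ν i g = 1 := fun g hg i => by
    have h := congrFun hg i
    rwa [MonoidHom.pi_apply, Pi.one_apply] at h
  refine hasNormalSylow_of_ker_isPGroup (pi_units_eq_one_of_pow_char_eq_one p) f ?_
  apply isPGroup_of_forall_coprime_eq_one
  rintro ⟨h, hh⟩ hcop
  rw [Subgroup.orderOf_mk] at hcop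
  by_contra hne
  have hne' : h ≠ 1 := fun h1 => hne (Subtype.ext h1)
  obtain ⟨i, hi⟩ := hfix h hne' hcop
  exact hz2 i (mem_sq_of_mem_augIdeal_sup p τ hres hcop hi
    (hν i h (hf h (MonoidHom.mem_ker.mp hh) i)))

/-- **Set form**: the same criterion with the boundary equations given as a finite set `B ⊆ 𝔪 ∖ 𝔪²`.
[folklore] -/
theorem hasNormalSylow_of_tameFix_le_boundary_finset (p : ℕ) [Fact p.Prime]
    [CharP (ResidueField R) p] [Finite I] (τ : I →* (R ≃+* R))
    (hres : ∀ (g : I) (r : R), τ g r - r ∈ maximalIdeal R) (B : Finset R)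
    (hB : ∀ b ∈ B, b ∈ maximalIdeal R) (hB2 : ∀ b ∈ B, b ∉ maximalIdeal R ^ 2)
    (hstab : ∀ (g : I), ∀ b ∈ B, τ g b ∈ Ideal.span {b} ⊔ maximalIdeal R ^ 2)
    (hfix : ∀ g : I, g ≠ 1 → (orderOf g).Coprime p →
      ∃ b ∈ B, b ∈ augIdeal (τ g) ⊔ maximalIdeal R ^ 2) :
    HasNormalSylow p I := by
  classical
  refine hasNormalSylow_of_tameFix_le_boundary p τ hres (r := B.card) (fun i => B.equivFin.symm i)
    (fun i => hB _ (B.equivFin.symm i).2) (fun i => hB2 _ (B.equivFin.symm i).2)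
    (fun g i => hstab g _ (B.equivFin.symm i).2) fun g hg hcop => ?_
  obtain ⟨b, hb, hmem⟩ := hfix g hg hcop
  exact ⟨B.equivFin ⟨b, hb⟩, by rwa [Equiv.symm_apply_apply]⟩

/-- **No boundary**: if every element of `I` of order prime to `p` is trivial-or-wild — i.e. the
hypothesis of the criterion holds with the EMPTY boundary because `I` has no non-trivial element of order
prime to `p` — then `I` is a `p`-group, hence p-closed; recorded as the degenerate case `r = 0` of the
criterion (points off the boundary: inertia a `p`-group). [folklore] -/
theorem hasNormalSylow_of_forall_coprime_eq_one (p : ℕ) [Fact p.Prime] [Finite I]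
    (h : ∀ g : I, (orderOf g).Coprime p → g = 1) : HasNormalSylow p I :=
  HasNormalSylow.of_isPGroup (isPGroup_of_forall_coprime_eq_one h)

/-- **The toral end state is a standard form** (comparison with ✓`TameEndState`): if the tame elements act
trivially on `𝔪 / ((z) + 𝔪²)` and, for each tame `g ≠ 1`, SOME boundary equation is moved to first order
(`τ g (z i) − z i ∉ 𝔪²` — automatic for a faithful tame `g` when the `z̄ᵢ` are independent, since
`(ḡ − 1)V ⊆ ⊕ κ z̄ᵢ` is then a non-zero sum of eigenlines), then that `z i` lies in `𝔞_{τ g} + 𝔪²`; so the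
standard-form hypothesis `hfix` holds. Here we record the elementary implication used:
`τ g (z i) − z i ∈ 𝔞_{τ g}`. [folklore] -/
theorem apply_sub_mem_augIdeal_sup (τ : I →* (R ≃+* R)) (g : I) (x : R) :
    τ g x - x ∈ augIdeal (τ g) ⊔ maximalIdeal R ^ 2 :=
  Ideal.mem_sup_left (sub_mem_augIdeal (τ g) x)

end LocalRing

end Summit.ResolutionOfSingularities.ResolutionOfSingularities.Theorems.WildQuotientResolution.StandardForm
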